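import Mathlib
import Summits.ResolutionOfSingularities.ResolutionOfSingularities.Theorems.WeightedInvariantLocalWeightedDropNCResSurfGraphEndgameData

/-!
# `WeightedInvariant.LocalWeightedDrop`: NC-resolution settings for the TOT₂ line — GRAPH SURFACES, part 26: THE MONOMIAL ENDGAME OF THE LOOP

Crux item stmt-ResolutionOfSingularities-8899 `LocalWeightedDrop` (route `ResolutionOfSingularities/WeightedInvariant`), ENGINE skeleton v34/v35, residual
`stub_wildWideApexFourStartsWon`; res-L1-w43-strat-1's line `directrix-cut` v3f, piece PL₃, sub-skeleton `pl3_split_v1` (7519a9009475ab47), stub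
`stub_apexPlaneSurfaceThree` = the SURFACE sub-case `ApexPlaneSurfaceExit`, reduced (…NCResSurfGraphRegime, p557720) to the loop `SurfLoop k m`.
Design memo `L/res-L1-w43-stub-4/g6/SURFLOOP-DESIGN.md`.  [OURS · L1 W4.3 · chain w43 · seat res-L1-w43-stub-4 gen 6; def-free, on parts 1–19 and 22
(…NCResSurfGraph*), res-L1-w43-stub-1's S-SET and res-L1-w43-lead-1's boundary bookkeeping (…NCResRegimeTransport); the count game is the programme's
own; nothing here is a statement of any manuscript; AI-produced, gate-checked, weaker than expert review.]

* `curveClause_monomial`, `pointClause_monomial` — the move clauses of the endgame with their successor data;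
* **`dWinsTo_endgame`** — from a valid MONOMIAL loop state the mover forces «admissibly decorated of smaller head, or a valid TERMINAL state of the same
  head (every boundary trace off the base vanishes)»: states carry their exponent table, the measure is the exponent multiset, the relation is
  `Endgame.Step`, and `Endgame.no_infinite_play` (part 22) feeds `DWinsTo.of_noChain` (…NCResPhaseAssembly).
-/

set_option linter.dupNamespace false -- mandated namespace of this single-conjunct summit

noncomputable section

namespace Summit.ResolutionOfSingularities.ResolutionOfSingularities.Theorems

namespace TameFourTupleDrop

namespace GraphSurf

namespace SurfDatum

open MvPowerSeries Literature.AlgebraicGeometry.Resolution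

variable {k : Type} [Field k] {m : ℕ}

/-- Off-base divisibility by `x₀` in a monomial state all of whose non-zero traces have `p ≥ 1`. -/
theorem hE_of_C₁Avail {σ : SurfDatum k m} (hσ : σ.Valid) {e : Fin (m + 1) → ℕ × ℕ} (hmono : σ.IsMonomial e)
    (hC₁ : Endgame.C₁Avail (σ.expMultiset e)) : ∀ l ∈ σ.off, (X 0 : MvPowerSeries (Fin 2) k) ∣ σ.ψ l := by
  intro l hl
  by_cases h0 : σ.ψ l = 0
  · rw [h0]; exact dvd_zero _
  · obtain ⟨u, -, he, -⟩ := hmono.eq_of_ne_zero hσ hl h0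
    have hp : 1 ≤ (e l).1 := hC₁ (e l) (mem_expMultiset_iff.mpr ⟨l, hl, h0, rfl⟩)
    refine ⟨u * X 0 ^ ((e l).1 - 1) * X 1 ^ (e l).2, ?_⟩
    rw [he]
    conv_lhs => rw [← Nat.sub_add_cancel hp, pow_succ']
    ring

/-- **THE CURVE-MOVE CLAUSE OF THE ENDGAME** (every non-zero trace divisible by `x₀`): every answer drops the head or leads to a valid monomial
state of the same head with exponent multiset `moveC₁`. -/
theorem curveClause_monomial [Infinite k] {σ : SurfDatum k m} (hσ : σ.Valid) {e : Fin (m + 1) → ℕ × ℕ} (hmono : σ.IsMonomial e)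
    (hC₁ : Endgame.C₁Avail (σ.expMultiset e)) :
    MoveClause σ.b₀ σ.curveΦ σ.curveW (fun b' => ∃ (σ' : SurfDatum k m) (e' : Fin (m + 1) → ℕ × ℕ), σ'.b₀ = b' ∧ Admissible σ'.b₀ σ'.δ ∧
      (σ'.δ.head < σ.δ.head ∨ (σ'.δ.head = σ.δ.head ∧ σ'.Valid ∧ σ'.IsMonomial e' ∧
        σ'.expMultiset e' = Endgame.moveC₁ (σ.expMultiset e)))) := by
  have hE := hE_of_C₁Avail hσ hmono hC₁
  have hpermB := isBPermissible_curve hσ hE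
  have hf : σ.δ.f ≠ 0 := hσ.1.2.1.ne_zero
  intro c hc0 hcne A G hfac hG
  have hgen : ∀ s, c s ≠ 0 → Admissible (X 0 * TupleGame.slice s G) (σ.δ.transform σ.curveΦ σ.curveW c s) ∧
      (σ.δ.transform σ.curveΦ σ.curveW c s).head ≤ σ.δ.head := fun s hs =>
    ⟨admissible_transform hσ.1 hpermB hc0 hfac hG hs, Decoration.head_transform_le hpermB hc0 hf hs⟩
  obtain ⟨s₀, hs₀⟩ : ∃ s, c s ≠ 0 := Function.ne_iff.mp hcne
  by_cases hlt₀ : (σ.δ.transform σ.curveΦ σ.curveW c s₀).head < σ.δ.head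
  · exact ⟨s₀, hs₀, ⟨X 0 * TupleGame.slice s₀ G, _, σ.a, σ.b, σ.ψ⟩, e, rfl, (hgen s₀ hs₀).1, Or.inl hlt₀⟩
  have hhead₀ : (σ.δ.transform σ.curveΦ σ.curveW c s₀).head = σ.δ.head := le_antisymm (hgen s₀ hs₀).2 (not_lt.mp hlt₀)
  obtain ⟨hc', hca⟩ := curve_tangent_of_head_eq hσ hE hc0 hs₀ hhead₀
  set σ' := σ.curveSucc c G with hσ'
  refine ⟨σ.a, hca, σ', ?_⟩
  by_cases hlt : σ'.δ.head < σ.δ.head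
  · exact ⟨e, rfl, admissible_curveSucc hσ hE hc0 hfac hG hca, Or.inl hlt⟩
  have hhead : σ'.δ.head = σ.δ.head := le_antisymm (head_curveSucc_le hσ hE hc0 G hca) (not_lt.mp hlt)
  have hval := valid_curveSucc hσ hE hc0 hc' hca hfac hG hhead
  obtain ⟨e', hmono', hmult'⟩ := exists_table_curveSucc hσ hmono hC₁ hc' hca G
  exact ⟨e', rfl, hval.1, Or.inr ⟨hhead, hval, hmono', hmult'⟩⟩

/-- **THE POINT-MOVE CLAUSE OF THE ENDGAME**: every answer drops the head or leads to a valid monomial state of the same head with exponent multiset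
`moveA`, `moveB` or `moveG`. -/
theorem pointClause_monomial [Infinite k] {σ : SurfDatum k m} (hσ : σ.Valid) {e : Fin (m + 1) → ℕ × ℕ} (hmono : σ.IsMonomial e) :
    MoveClause σ.b₀ (fun j => (X j : MvPowerSeries (Fin (m + 1)) k)) (fun _ => 1)
      (fun b' => ∃ (σ' : SurfDatum k m) (e' : Fin (m + 1) → ℕ × ℕ), σ'.b₀ = b' ∧ Admissible σ'.b₀ σ'.δ ∧
      (σ'.δ.head < σ.δ.head ∨ (σ'.δ.head = σ.δ.head ∧ σ'.Valid ∧ σ'.IsMonomial e' ∧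
        (σ'.expMultiset e' = Endgame.moveA (σ.expMultiset e) ∨ σ'.expMultiset e' = Endgame.moveB (σ.expMultiset e) ∨
          σ'.expMultiset e' = Endgame.moveG (σ.expMultiset e))))) := by
  classical
  have hf : σ.δ.f ≠ 0 := hσ.1.2.1.ne_zero
  have hpermX := isBPermissible_point_X σ.δ
  have hconv : ∀ (c : Fin (m + 1) → k) (l : Fin (m + 1)), (fun _ : Fin (m + 1) => (1 : ℕ)) l = 0 → c l = 0 :=
    fun _ _ h => absurd h one_ne_zero
  intro c hc0 hcne A G hfacX hG
  have hfac : subst (CobordantChart.chart (fun _ : Fin (m + 1) => 1) c) σ.b₀ = X 0 ^ A * G := by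
    rw [show subst (fun j => (X j : MvPowerSeries (Fin (m + 1)) k)) σ.b₀ = σ.b₀ from congrFun subst_self _] at hfacX
    exact hfacX
  have hgen : ∀ s, c s ≠ 0 →
      Admissible (X 0 * TupleGame.slice s G) (σ.δ.transform (fun j => (X j : MvPowerSeries (Fin (m + 1)) k)) (fun _ => 1) c s) ∧
        (σ.δ.transform (fun j => (X j : MvPowerSeries (Fin (m + 1)) k)) (fun _ => 1) c s).head ≤ σ.δ.head := fun s hs =>
    ⟨admissible_transform hσ.1 hpermX (hconv c) hfacX hG hs, Decoration.head_transform_le hpermX (hconv c) hf hs⟩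
  obtain ⟨s₀, hs₀⟩ : ∃ s, c s ≠ 0 := Function.ne_iff.mp hcne
  by_cases hlt₀ : (σ.δ.transform (fun j => (X j : MvPowerSeries (Fin (m + 1)) k)) (fun _ => 1) c s₀).head < σ.δ.head
  · exact ⟨s₀, hs₀, ⟨X 0 * TupleGame.slice s₀ G, _, σ.a, σ.b, σ.ψ⟩, e, rfl, (hgen s₀ hs₀).1, Or.inl hlt₀⟩
  have hhead₀ : (σ.δ.transform (fun j => (X j : MvPowerSeries (Fin (m + 1)) k)) (fun _ => 1) c s₀).head = σ.δ.head :=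
    le_antisymm (hgen s₀ hs₀).2 (not_lt.mp hlt₀)
  obtain ⟨hc', hab0⟩ := tangent_of_head_eq hσ hs₀ hhead₀
  by_cases hca : c σ.a ≠ 0
  · -- read at `a`: outcome A or G
    set σ' := σ.pointSucc c G with hσ'
    refine ⟨σ.a, hca, σ', ?_⟩
    by_cases hlt : σ'.δ.head < σ.δ.head
    · exact ⟨e, rfl, admissible_pointSucc hσ hfac hG hca, Or.inl hlt⟩
    have hhead : σ'.δ.head = σ.δ.head := le_antisymm (head_pointSucc_le hσ c G hca) (not_lt.mp hlt)
    have hval := valid_pointSucc hσ hc' hca hfac hG hhead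
    obtain ⟨e', hmono', hmult'⟩ := exists_table_pointSucc hσ hmono hc' hca G
    refine ⟨e', rfl, hval.1, Or.inr ⟨hhead, hval, hmono', ?_⟩⟩
    by_cases hμ : c σ.b = 0
    · rw [if_pos hμ] at hmult'
      exact Or.inl hmult'
    · rw [if_neg hμ] at hmult'
      exact Or.inr (Or.inr hmult')
  · -- read at `b` (`c_a = 0`, `c_b ≠ 0`): outcome B
    have hca0 : c σ.a = 0 := not_not.mp hca
    have hcb : c σ.b ≠ 0 := hab0.resolve_left hca
    set σ' := σ.swap.pointSucc c G with hσ'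
    refine ⟨σ.b, hcb, σ', ?_⟩
    by_cases hlt : σ'.δ.head < σ.δ.head
    · exact ⟨e, rfl, admissible_pointSucc hσ.swap hfac hG hcb, Or.inl hlt⟩
    have hhead : σ'.δ.head = σ.δ.head := le_antisymm (head_pointSucc_le hσ.swap c G hcb) (not_lt.mp hlt)
    have hcsw := eq_combo_tangent_swap hσ.2.1 hc'
    have hval := valid_pointSucc hσ.swap hcsw hcb hfac hG hhead
    obtain ⟨e', hmono', hmult'⟩ := exists_table_pointSucc hσ.swap hmono.swap hcsw hcb G
    refine ⟨e', rfl, hval.1, Or.inr ⟨hhead, hval, hmono', Or.inr (Or.inl ?_)⟩⟩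
    rw [hmult', swap_bLetter, if_pos hca0, expMultiset_swap, moveA_map_swap]

/-- **THE MONOMIAL ENDGAME** (OURS · L1 W4.3; memo §3): from a valid monomial loop state the mover forces «admissibly decorated of smaller head, or a
valid TERMINAL state of the same head (every boundary trace off the base is zero)».  States carry their exponent table; the measure is the exponent
multiset, the step relation is the combinatorial `Endgame.Step`, and `Endgame.no_infinite_play` supplies the well-foundedness (`DWinsTo.of_noChain`). -/
theorem dWinsTo_endgame [Infinite k] {σ₀ : SurfDatum k m} (hσ₀ : σ₀.Valid) {e₀ : Fin (m + 1) → ℕ × ℕ} (hmono₀ : σ₀.IsMonomial e₀) :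
    DWinsTo (St := SurfDatum k m × (Fin (m + 1) → ℕ × ℕ)) (fun τ => τ.1.b₀)
      (fun τ => (Admissible τ.1.b₀ τ.1.δ ∧ τ.1.δ.head < σ₀.δ.head) ∨
        (τ.1.Valid ∧ τ.1.δ.head = σ₀.δ.head ∧ ∀ l ∈ τ.1.off, τ.1.ψ l = 0)) (σ₀, e₀) := by
  classical
  refine DWinsTo.of_noChain (germ := fun τ : SurfDatum k m × (Fin (m + 1) → ℕ × ℕ) => τ.1.b₀)
    {τ | τ.1.Valid ∧ τ.1.δ.head = σ₀.δ.head ∧ τ.1.IsMonomial τ.2} (r := fun M' M => Endgame.Step M M')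
    (fun f hf => Endgame.no_infinite_play f hf) (fun τ => τ.1.expMultiset τ.2) (fun τ hτ hQ => ?_) ⟨hσ₀, rfl, hmono₀⟩
  obtain ⟨hval, hhead, hmono⟩ := hτ
  obtain ⟨σ, e⟩ := τ
  simp only at hval hhead hmono hQ ⊢
  set M := σ.expMultiset e with hM
  -- not terminal: some non-zero trace
  have hM0 : M ≠ 0 := by
    intro hM0
    refine hQ (Or.inr ⟨hval, hhead, fun l hl => ?_⟩)
    by_contra hne
    have : e l ∈ M := mem_expMultiset_iff.mpr ⟨l, hl, hne, rfl⟩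
    rw [hM0] at this
    exact Multiset.notMem_zero _ this
  have h00 := expMultiset_ne_zero_zero hmono hval
  -- successors: head drop or a valid monomial state of the same head with the combinatorial successor multiset
  have pack : ∀ (σ' : SurfDatum k m) (e' : Fin (m + 1) → ℕ × ℕ) (b' : MvPowerSeries (Fin (m + 1)) k), σ'.b₀ = b' → Admissible σ'.b₀ σ'.δ →
      (σ'.δ.head < σ.δ.head ∨ (σ'.δ.head = σ.δ.head ∧ σ'.Valid ∧ σ'.IsMonomial e' ∧ Endgame.Step M (σ'.expMultiset e'))) →
      ∃ τ' : SurfDatum k m × (Fin (m + 1) → ℕ × ℕ), τ'.1.b₀ = b' ∧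
        (((Admissible τ'.1.b₀ τ'.1.δ ∧ τ'.1.δ.head < σ₀.δ.head) ∨ (τ'.1.Valid ∧ τ'.1.δ.head = σ₀.δ.head ∧ ∀ l ∈ τ'.1.off, τ'.1.ψ l = 0)) ∨
          (τ' ∈ {τ : SurfDatum k m × (Fin (m + 1) → ℕ × ℕ) | τ.1.Valid ∧ τ.1.δ.head = σ₀.δ.head ∧ τ.1.IsMonomial τ.2} ∧
            Endgame.Step M (τ'.1.expMultiset τ'.2))) := by
    intro σ' e' b' hb' hadm' h
    refine ⟨(σ', e'), hb', ?_⟩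
    rcases h with hlt | ⟨heq, hval', hmono', hstep⟩
    · exact Or.inl (Or.inl ⟨hadm', lt_of_lt_of_eq hlt hhead⟩)
    · exact Or.inr ⟨⟨hval', heq.trans hhead, hmono'⟩, hstep⟩
  by_cases hC₁ : Endgame.C₁Avail M
  · refine ⟨σ.curveΦ, σ.curveW, (isBPermissible_curve hval (hE_of_C₁Avail hval hmono hC₁)).1,
      (curveClause_monomial hval hmono hC₁).mono fun b' => ?_⟩
    rintro ⟨σ', e', hb', hadm', h⟩
    refine pack σ' e' b' hb' hadm' (h.imp_right fun ⟨heq, hval', hmono', hmult⟩ => ⟨heq, hval', hmono', ?_⟩)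
    exact ⟨hM0, h00, Or.inl ⟨hC₁, hmult⟩⟩
  by_cases hC₂ : Endgame.C₂Avail M
  · have hC₁' : Endgame.C₁Avail (σ.swap.expMultiset fun l => ((e l).2, (e l).1)) := by
      rw [expMultiset_swap, C₁Avail_map_swap]; exact hC₂
    refine ⟨σ.swap.curveΦ, σ.swap.curveW, (isBPermissible_curve hval.swap (hE_of_C₁Avail hval.swap hmono.swap hC₁')).1,
      (curveClause_monomial hval.swap hmono.swap hC₁').mono fun b' => ?_⟩
    rintro ⟨σ', e', hb', hadm', h⟩
    refine pack σ' e' b' hb' hadm' (h.imp_right fun ⟨heq, hval', hmono', hmult⟩ => ⟨heq, hval', hmono', ?_⟩)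
    rw [expMultiset_swap, moveC₁_map_swap] at hmult
    exact ⟨hM0, h00, Or.inr (Or.inl ⟨hC₁, hC₂, hmult⟩)⟩
  · refine ⟨fun j => X j, fun _ => 1, (isBPermissible_point_X σ.δ).1, (pointClause_monomial hval hmono).mono fun b' => ?_⟩
    rintro ⟨σ', e', hb', hadm', h⟩
    refine pack σ' e' b' hb' hadm' (h.imp_right fun ⟨heq, hval', hmono', hmult⟩ => ⟨heq, hval', hmono', ?_⟩)
    exact ⟨hM0, h00, Or.inr (Or.inr ⟨hC₁, hC₂, hmult⟩)⟩

end SurfDatum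

end GraphSurf

end TameFourTupleDrop

end Summit.ResolutionOfSingularities.ResolutionOfSingularities.Theorems

end
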